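import Summits.QuantumFields.YangMills.Theorems.UnitScaleTiltProp7TrueLinPureGaugeIter
import HarnessLib

/-!
# Route `UnitScaleTilt`, crux K1 «MinimiserStabilityRegPr» (stmt-QuantumFields-19200), route-R [RP] curved, the curved N6 row (R-A) of
# `CURVED-N6-LOCATED-w2g2.md` §2 in its ALGEBRAIC form — THE `k`-FOLD STRUCTURE RECURSION OF THE TRUE LINEARISED (0.4)-DESCENT AT A CURVED BACKGROUND:
# `T^{(j)}(U₀)Y = G_j + P_{Ū₀^{(j)}}Λ_j` EXACTLY, with `G_{j+1} = T_jG_j − P_{Ū₀^{(j+1)}}(CM_jG_j)`, `Λ_{j+1} = CM_jG_j + Λ_j ∘ emb`, for ANY coarse-site maps `CM_j`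

Cell `ym3-torus`, width seat `ym-ust-20520-w2` (g3); sequel of bricks 4–5 (✓ p603693 `…TrueLinPureGauge`, ✓ p605789 `…TrueLinPureGaugeIter`).  THEOREMS ONLY (0 `def`,
0 `sorry`); `--supports stmt-QuantumFields-19200`, count-neutral.  YM₃ on T³ is a ladder rung (R3), not the Clay problem; nothing here claims the curved N6 bounds,
S2, P, the crux or the gap.

THE POINT.  ★p1's flat structure theorem `Prop7IterLinStructureRec.iterLin_eq_of_iterLambda` (`Q^{(k)}Y = L^k·Q_kY − ∇Λ_kY`) rests on two properties of the
flat one-step operator `linAvg`: linearity and exactness on pure gauges ([Balaban1984PropagatorsI] (1.20)), which route the gradient part `∇Λ_j` through each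
level unchanged while the remainder is re-split as «straight-line part + ∇(comb mean)».  At a curved background the same two properties hold for the TRUE
one-step linearisation `T_j = T(Ū₀^{(j)})` (brick 5 §1 and brick 4), with the covariant pure-gauge letter `P_Vξ(b) = ξ(b₋) − V_b·ξ(b₊)·V_b*`.  Hence, for ANY
family of maps `CM_j : (j-bond fields) → ((j+1)-site functions)` (intended: the covariant comb mean `|I|⁻¹Σ_i Z_{Ū₀^{(j)}}(Γ^{σ_i}_{emb z → x_i})` of brick 1, for
which `T_j − P∘CM_j` is the comb-transported covariant straight-line mean up to `O(α_j)` — the next file), the recursion families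
`G_0 = Y`, `G_{j+1}(c) = T_jG_j(c) − P_{Ū₀^{(j+1)}}(CM_jG_j)(c)` («reduced» part) and `Λ_0 = 0`, `Λ_{j+1}(z) = CM_jG_j(z) + Λ_j(emb z)` (coarse gauge function)
satisfy `Q j Y = G_j + P_{Ū₀^{(j)}}Λ_j` IDENTICALLY under the per-level (0.4) guards.  On the constraint surface `Q k Y = 0` this reads `G_k = −P_{Ū₀^{(k)}}Λ_k`,
so `‖G_k(c)‖ ≤ ‖Λ_k(c₋)‖ + ‖Λ_k(c₊)‖` (unitary transport) — the shape of ✓ p601741's displayed `hA` once `G_k` is identified with the engine's covariant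
straight-line block functional (row (R-C): transports and `O(α)` defects) and `Λ_k` is bounded in `(H¹)^*` (row (R-B)).

WHAT IS PROVED (ns `…Theorems.Prop7TrueLinIterStructure`; the one-step operator and `P_V` WRITTEN OUT, `Q`, `G`, `Λ`, `CM` abstract by recursion hypotheses).
* §1 `pureGauge_add_apply` — `P_V(ξ + ξ′)(c) = P_Vξ(c) + P_Vξ′(c)`; `norm_pureGauge_le` — `‖P_Vξ(c)‖ ≤ ‖ξ(c₋)‖ + ‖ξ(c₊)‖` for special-unitary `V`.
* §2 ★★ `trueLinIter_structure` — `∀ k, (guards below k) → ∀ c, Q k Y c = G k c + P_{Ū₀^{(k)}}(Λ k)(c)`.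
* §3 ★ `norm_reduced_le_of_structure` — `‖G k c‖ ≤ ‖Q k Y c‖ + ‖Λ k c₋‖ + ‖Λ k c₊‖` (for M10(b)'s `O(Y²)` constraint value as well as the exact constraint);
  `reduced_eq_neg_pureGauge_of_constraint` — `Q k Y c = 0 → G k c = −P_{Ū₀^{(k)}}(Λ k)(c)`.
HONEST SCOPE.  Identities and the triangle inequality; `CM_j` is arbitrary here.  The analytic rows — (R-A′) one step: `T_j − P∘CM_j = LINE_j + O(α_j)` for the
covariant comb mean; (R-B) `Σ‖Λ_k‖² ≤ c_Λ L^k G`; (R-C) `G_k` versus the engine's `A^{U₀}` with `Σ_cE_c² ≤ c_E L^{5k}ε²Σ‖Y‖²` — are separate files.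

References: T. Bałaban, CMP 95 (1984) 17–40 [Balaban1984PropagatorsI] ((1.18)–(1.20) pp.19–20); CMP 98 (1985) 17–51 [Balaban1985Averaging] ((11) p.19, (62) p.28,
(124)–(125) p.36); CMP 102 (1985) 277–309 [Balaban1985Variational] (Prop. 7 p.299).
-/

noncomputable section

open scoped BigOperators Matrix.Norms.L2Operator

namespace Summit.QuantumFields.YangMills.Theorems.Prop7TrueLinIterStructure

open Literature.MathematicalPhysics.QuantumFieldTheory.Balaban1983to89
open Finset T4Continuum BlockAveraging AveragingRT ExpMeanLog BlockAveragingEMLLinearised BlockAveragingEMLLinearisedBackground BlockAveragingEMLProp2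
open Summit.QuantumFields.YangMills.Theorems.Prop7HolRatioPerStep (norm_coe_eq_one norm_star_coe_eq_one)
open Summit.QuantumFields.YangMills.Theorems.Prop7TrueLinPureGauge (trueLin_pureGauge)
open Summit.QuantumFields.YangMills.Theorems.Prop7TrueLinPureGaugeIter (trueLin_add)

variable {P : Params} {n : Type*} [Fintype n] [DecidableEq n] [Nonempty n] {j : ℕ}

/-! ## §1 The covariant pure-gauge letter `P_Vξ(c) = ξ(c₋) − V(c)·ξ(c₊)·V(c)*` -/

omit [Nonempty n] in
/-- `P_V` is additive in the site function. [cite: Balaban1985Averaging, (11) p.19] -/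
theorem pureGauge_add_apply (V : GaugeField P j (Matrix.specialUnitaryGroup n ℂ)) (ξ ξ' : Site P j → Matrix n n ℂ) (c : PBond P j) :
    (ξ c.src + ξ' c.src) - ((V c : Matrix.specialUnitaryGroup n ℂ) : Matrix n n ℂ) * (ξ c.tgt + ξ' c.tgt) * star ((V c : Matrix.specialUnitaryGroup n ℂ) : Matrix n n ℂ)
      = (ξ c.src - ((V c : Matrix.specialUnitaryGroup n ℂ) : Matrix n n ℂ) * ξ c.tgt * star ((V c : Matrix.specialUnitaryGroup n ℂ) : Matrix n n ℂ))
        + (ξ' c.src - ((V c : Matrix.specialUnitaryGroup n ℂ) : Matrix n n ℂ) * ξ' c.tgt * star ((V c : Matrix.specialUnitaryGroup n ℂ) : Matrix n n ℂ)) := by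
  noncomm_ring

/-- `‖P_Vξ(c)‖ ≤ ‖ξ(c₋)‖ + ‖ξ(c₊)‖` (the transport by a special-unitary bond variable is an isometry). [cite: Balaban1985Averaging, (11) p.19] -/
theorem norm_pureGauge_le (V : GaugeField P j (Matrix.specialUnitaryGroup n ℂ)) (ξ : Site P j → Matrix n n ℂ) (c : PBond P j) :
    ‖ξ c.src - ((V c : Matrix.specialUnitaryGroup n ℂ) : Matrix n n ℂ) * ξ c.tgt * star ((V c : Matrix.specialUnitaryGroup n ℂ) : Matrix n n ℂ)‖
      ≤ ‖ξ c.src‖ + ‖ξ c.tgt‖ := by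
  refine (norm_sub_le _ _).trans (add_le_add le_rfl ?_)
  calc _ ≤ ‖((V c : Matrix.specialUnitaryGroup n ℂ) : Matrix n n ℂ)‖ * ‖ξ c.tgt‖ * ‖star ((V c : Matrix.specialUnitaryGroup n ℂ) : Matrix n n ℂ)‖ :=
        (norm_mul_le _ _).trans (mul_le_mul_of_nonneg_right (norm_mul_le _ _) (norm_nonneg _))
    _ = ‖ξ c.tgt‖ := by rw [norm_coe_eq_one, norm_star_coe_eq_one, one_mul, mul_one]

/-! ## §2 ★★ The structure recursion -/

/-- ★★ **THE `k`-FOLD STRUCTURE RECURSION OF THE TRUE LINEARISED (0.4)-DESCENT AT A CURVED BACKGROUND.**  Background tower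
`Ū₀^{(j)} = Averaging.iter (blockAvg ℰp) j U₀`; `Q` any composite of the true one-step linearisations along it (`hQ0`, `hQs`); `CM j` ANY maps from `j`-bond fields to
`(j+1)`-site functions; `G`, `Λ` the recursion families `G 0 = Y`, `G (j+1) c = T_j(G j)(c) − P_{Ū₀^{(j+1)}}(CM j (G j))(c)`, `Λ 0 = 0`, `Λ (j+1) z = CM j (G j) z + Λ j (emb z)`.
Then under the per-level (0.4) guards `dist1(W^{(j)}_i(c)) < δ_N` (`j < k`):  `Q k Y c = G k c + (Λ k c₋ − Ū₀^{(k)}(c)·Λ k c₊·Ū₀^{(k)}(c)*)` for every `k`-bond `c`.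
(Linearity of `T_j`, brick 5, and exactness of `T_j` on the pure gauge `P_{Ū₀^{(j)}}(Λ j)`, brick 4.) [cite: Balaban1984PropagatorsI, (1.18)-(1.20) pp.19-20] -/
theorem trueLinIter_structure (U₀ : GaugeField P 0 (Matrix.specialUnitaryGroup n ℂ))
    (Q : (k : ℕ) → (PBond P 0 → Matrix n n ℂ) → PBond P k → Matrix n n ℂ) (hQ0 : ∀ Y, Q 0 Y = Y)
    (hQs : ∀ (k : ℕ) (Y : PBond P 0 → Matrix n n ℂ) (c : PBond P (k + 1)), Q (k + 1) Y c
      = fderiv ℂ (eml : (Idx P → Matrix n n ℂ) → Matrix n n ℂ)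
            (fun i => ((loopHol (Averaging.iter (fun i => blockAvg (P := P) (j := i) (expMeanLogSU (n := n))) k U₀) c i :
              Matrix.specialUnitaryGroup n ℂ) : Matrix n n ℂ))
            (fun i => covWalkSum (Averaging.iter (fun i => blockAvg (P := P) (j := i) (expMeanLogSU (n := n))) k U₀) (Q k Y)
                (walk (emb c.src) (loopWord P.L c.dir (off i.1) i.2.1 i.2.2))
              * ((loopHol (Averaging.iter (fun i => blockAvg (P := P) (j := i) (expMeanLogSU (n := n))) k U₀) c i :
                Matrix.specialUnitaryGroup n ℂ) : Matrix n n ℂ))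
            * star ((corr (expMeanLogSU (n := n)) (Averaging.iter (fun i => blockAvg (P := P) (j := i) (expMeanLogSU (n := n))) k U₀) c :
                Matrix.specialUnitaryGroup n ℂ) : Matrix n n ℂ)
          + ((corr (expMeanLogSU (n := n)) (Averaging.iter (fun i => blockAvg (P := P) (j := i) (expMeanLogSU (n := n))) k U₀) c :
                Matrix.specialUnitaryGroup n ℂ) : Matrix n n ℂ)
            * covWalkSum (Averaging.iter (fun i => blockAvg (P := P) (j := i) (expMeanLogSU (n := n))) k U₀) (Q k Y)
                (walk (emb c.src) (List.replicate P.L (c.dir, true)))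
            * star ((corr (expMeanLogSU (n := n)) (Averaging.iter (fun i => blockAvg (P := P) (j := i) (expMeanLogSU (n := n))) k U₀) c :
                Matrix.specialUnitaryGroup n ℂ) : Matrix n n ℂ))
    (Y : PBond P 0 → Matrix n n ℂ)
    (CM : (k : ℕ) → (PBond P k → Matrix n n ℂ) → Site P (k + 1) → Matrix n n ℂ)
    (G : (k : ℕ) → PBond P k → Matrix n n ℂ) (Λ : (k : ℕ) → Site P k → Matrix n n ℂ)
    (hG0 : ∀ b, G 0 b = Y b) (hΛ0 : ∀ x, Λ 0 x = 0)
    (hΛs : ∀ (k : ℕ) (z : Site P (k + 1)), Λ (k + 1) z = CM k (G k) z + Λ k (emb z))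
    (hGs : ∀ (k : ℕ) (c : PBond P (k + 1)), G (k + 1) c
      = (fderiv ℂ (eml : (Idx P → Matrix n n ℂ) → Matrix n n ℂ)
            (fun i => ((loopHol (Averaging.iter (fun i => blockAvg (P := P) (j := i) (expMeanLogSU (n := n))) k U₀) c i :
              Matrix.specialUnitaryGroup n ℂ) : Matrix n n ℂ))
            (fun i => covWalkSum (Averaging.iter (fun i => blockAvg (P := P) (j := i) (expMeanLogSU (n := n))) k U₀) (G k)
                (walk (emb c.src) (loopWord P.L c.dir (off i.1) i.2.1 i.2.2))
              * ((loopHol (Averaging.iter (fun i => blockAvg (P := P) (j := i) (expMeanLogSU (n := n))) k U₀) c i :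
                Matrix.specialUnitaryGroup n ℂ) : Matrix n n ℂ))
            * star ((corr (expMeanLogSU (n := n)) (Averaging.iter (fun i => blockAvg (P := P) (j := i) (expMeanLogSU (n := n))) k U₀) c :
                Matrix.specialUnitaryGroup n ℂ) : Matrix n n ℂ)
          + ((corr (expMeanLogSU (n := n)) (Averaging.iter (fun i => blockAvg (P := P) (j := i) (expMeanLogSU (n := n))) k U₀) c :
                Matrix.specialUnitaryGroup n ℂ) : Matrix n n ℂ)
            * covWalkSum (Averaging.iter (fun i => blockAvg (P := P) (j := i) (expMeanLogSU (n := n))) k U₀) (G k)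
                (walk (emb c.src) (List.replicate P.L (c.dir, true)))
            * star ((corr (expMeanLogSU (n := n)) (Averaging.iter (fun i => blockAvg (P := P) (j := i) (expMeanLogSU (n := n))) k U₀) c :
                Matrix.specialUnitaryGroup n ℂ) : Matrix n n ℂ))
        - (CM k (G k) c.src
            - ((Averaging.iter (fun i => blockAvg (P := P) (j := i) (expMeanLogSU (n := n))) (k + 1) U₀ c : Matrix.specialUnitaryGroup n ℂ) :
                Matrix n n ℂ) * CM k (G k) c.tgt
              * star ((Averaging.iter (fun i => blockAvg (P := P) (j := i) (expMeanLogSU (n := n))) (k + 1) U₀ c :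
                Matrix.specialUnitaryGroup n ℂ) : Matrix n n ℂ))) :
    ∀ k : ℕ, (∀ j < k, ∀ (c : PBond P (j + 1)) (i : Idx P),
        dist1 (loopHol (Averaging.iter (fun i => blockAvg (P := P) (j := i) (expMeanLogSU (n := n))) j U₀) c i) < deltaSU n) →
      ∀ c : PBond P k, Q k Y c
        = G k c + (Λ k c.src
            - ((Averaging.iter (fun i => blockAvg (P := P) (j := i) (expMeanLogSU (n := n))) k U₀ c : Matrix.specialUnitaryGroup n ℂ) : Matrix n n ℂ)
              * Λ k c.tgt
              * star ((Averaging.iter (fun i => blockAvg (P := P) (j := i) (expMeanLogSU (n := n))) k U₀ c : Matrix.specialUnitaryGroup n ℂ) :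
                  Matrix n n ℂ)) := by
  intro k
  induction k with
  | zero =>
    intro _ c
    rw [hQ0, hG0, hΛ0, hΛ0, mul_zero, zero_mul, sub_zero, add_zero]
  | succ k ih =>
    intro hg c
    -- the level-`k` split as a function, from the induction hypothesis
    have hfun : Q k Y = G k + fun b : PBond P k => Λ k b.src
        - ((Averaging.iter (fun i => blockAvg (P := P) (j := i) (expMeanLogSU (n := n))) k U₀ b : Matrix.specialUnitaryGroup n ℂ) : Matrix n n ℂ)
          * Λ k b.tgt
          * star ((Averaging.iter (fun i => blockAvg (P := P) (j := i) (expMeanLogSU (n := n))) k U₀ b : Matrix.specialUnitaryGroup n ℂ) :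
              Matrix n n ℂ) :=
      funext fun b => by rw [Pi.add_apply]; exact ih (fun j hj => hg j (Nat.lt_succ_of_lt hj)) b
    have hit : Averaging.iter (fun i => blockAvg (P := P) (j := i) (expMeanLogSU (n := n))) (k + 1) U₀
        = avgFun (expMeanLogSU (n := n)) (Averaging.iter (fun i => blockAvg (P := P) (j := i) (expMeanLogSU (n := n))) k U₀) := rfl
    rw [hQs, hfun, trueLin_add, trueLin_pureGauge (Averaging.iter (fun i => blockAvg (P := P) (j := i) (expMeanLogSU (n := n))) k U₀) (Λ k) c
      (hg k (Nat.lt_succ_self k) c), hGs, hΛs, hΛs, hit]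
    -- `Ū₀^{(k+1)} = avgFun ℰp Ū₀^{(k)}` (`rfl`, rewritten); the rest is ring algebra
    noncomm_ring

/-! ## §3 On (and near) the constraint surface -/

/-- ★ **THE REDUCED PART IS CONTROLLED BY THE CONSTRAINT VALUE AND THE COARSE GAUGE FUNCTION**: from the structure identity,
`‖G k c‖ ≤ ‖Q k Y c‖ + ‖Λ k c₋‖ + ‖Λ k c₊‖` — with `Q k Y = 0` (the linearised fibre) or `Q k Y = O(Y²)` (★w4-19200's M10(b)). [cite: Balaban1985Variational, Prop. 7 p.299] -/
theorem norm_reduced_le_of_structure {k : ℕ} (V : GaugeField P k (Matrix.specialUnitaryGroup n ℂ)) {q g : Matrix n n ℂ} (Λ : Site P k → Matrix n n ℂ)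
    (c : PBond P k)
    (h : q = g + (Λ c.src - ((V c : Matrix.specialUnitaryGroup n ℂ) : Matrix n n ℂ) * Λ c.tgt * star ((V c : Matrix.specialUnitaryGroup n ℂ) : Matrix n n ℂ))) :
    ‖g‖ ≤ ‖q‖ + ‖Λ c.src‖ + ‖Λ c.tgt‖ := by
  have e : g = q - (Λ c.src - ((V c : Matrix.specialUnitaryGroup n ℂ) : Matrix n n ℂ) * Λ c.tgt * star ((V c : Matrix.specialUnitaryGroup n ℂ) : Matrix n n ℂ)) := by
    rw [h]; abel
  rw [e, add_assoc]
  exact (norm_sub_le _ _).trans (add_le_add le_rfl (norm_pureGauge_le V Λ c))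

omit [Nonempty n] in
/-- On the constraint surface `Q k Y c = 0` the reduced part IS minus the coarse covariant gradient: `G k c = −P_{Ū₀^{(k)}}(Λ k)(c)`.
[cite: Balaban1985Variational, Prop. 7 p.299] -/
theorem reduced_eq_neg_pureGauge_of_constraint {k : ℕ} (V : GaugeField P k (Matrix.specialUnitaryGroup n ℂ)) {q g : Matrix n n ℂ}
    (Λ : Site P k → Matrix n n ℂ) (c : PBond P k)
    (h : q = g + (Λ c.src - ((V c : Matrix.specialUnitaryGroup n ℂ) : Matrix n n ℂ) * Λ c.tgt * star ((V c : Matrix.specialUnitaryGroup n ℂ) : Matrix n n ℂ)))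
    (hq : q = 0) :
    g = -(Λ c.src - ((V c : Matrix.specialUnitaryGroup n ℂ) : Matrix n n ℂ) * Λ c.tgt * star ((V c : Matrix.specialUnitaryGroup n ℂ) : Matrix n n ℂ)) := by
  rw [hq] at h
  exact eq_neg_of_add_eq_zero_left h.symm

/-- The two together at the tower: under the hypotheses of `trueLinIter_structure`, for every `k`-bond `c`,
`‖G k c‖ ≤ ‖Q k Y c‖ + ‖Λ k c₋‖ + ‖Λ k c₊‖`. [cite: Balaban1985Variational, Prop. 7 p.299] -/
theorem norm_reduced_le (U₀ : GaugeField P 0 (Matrix.specialUnitaryGroup n ℂ))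
    (Q : (k : ℕ) → (PBond P 0 → Matrix n n ℂ) → PBond P k → Matrix n n ℂ) (hQ0 : ∀ Y, Q 0 Y = Y)
    (hQs : ∀ (k : ℕ) (Y : PBond P 0 → Matrix n n ℂ) (c : PBond P (k + 1)), Q (k + 1) Y c
      = fderiv ℂ (eml : (Idx P → Matrix n n ℂ) → Matrix n n ℂ)
            (fun i => ((loopHol (Averaging.iter (fun i => blockAvg (P := P) (j := i) (expMeanLogSU (n := n))) k U₀) c i :
              Matrix.specialUnitaryGroup n ℂ) : Matrix n n ℂ))
            (fun i => covWalkSum (Averaging.iter (fun i => blockAvg (P := P) (j := i) (expMeanLogSU (n := n))) k U₀) (Q k Y)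
                (walk (emb c.src) (loopWord P.L c.dir (off i.1) i.2.1 i.2.2))
              * ((loopHol (Averaging.iter (fun i => blockAvg (P := P) (j := i) (expMeanLogSU (n := n))) k U₀) c i :
                Matrix.specialUnitaryGroup n ℂ) : Matrix n n ℂ))
            * star ((corr (expMeanLogSU (n := n)) (Averaging.iter (fun i => blockAvg (P := P) (j := i) (expMeanLogSU (n := n))) k U₀) c :
                Matrix.specialUnitaryGroup n ℂ) : Matrix n n ℂ)
          + ((corr (expMeanLogSU (n := n)) (Averaging.iter (fun i => blockAvg (P := P) (j := i) (expMeanLogSU (n := n))) k U₀) c :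
                Matrix.specialUnitaryGroup n ℂ) : Matrix n n ℂ)
            * covWalkSum (Averaging.iter (fun i => blockAvg (P := P) (j := i) (expMeanLogSU (n := n))) k U₀) (Q k Y)
                (walk (emb c.src) (List.replicate P.L (c.dir, true)))
            * star ((corr (expMeanLogSU (n := n)) (Averaging.iter (fun i => blockAvg (P := P) (j := i) (expMeanLogSU (n := n))) k U₀) c :
                Matrix.specialUnitaryGroup n ℂ) : Matrix n n ℂ))
    (Y : PBond P 0 → Matrix n n ℂ)
    (CM : (k : ℕ) → (PBond P k → Matrix n n ℂ) → Site P (k + 1) → Matrix n n ℂ)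
    (G : (k : ℕ) → PBond P k → Matrix n n ℂ) (Λ : (k : ℕ) → Site P k → Matrix n n ℂ)
    (hG0 : ∀ b, G 0 b = Y b) (hΛ0 : ∀ x, Λ 0 x = 0)
    (hΛs : ∀ (k : ℕ) (z : Site P (k + 1)), Λ (k + 1) z = CM k (G k) z + Λ k (emb z))
    (hGs : ∀ (k : ℕ) (c : PBond P (k + 1)), G (k + 1) c
      = (fderiv ℂ (eml : (Idx P → Matrix n n ℂ) → Matrix n n ℂ)
            (fun i => ((loopHol (Averaging.iter (fun i => blockAvg (P := P) (j := i) (expMeanLogSU (n := n))) k U₀) c i :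
              Matrix.specialUnitaryGroup n ℂ) : Matrix n n ℂ))
            (fun i => covWalkSum (Averaging.iter (fun i => blockAvg (P := P) (j := i) (expMeanLogSU (n := n))) k U₀) (G k)
                (walk (emb c.src) (loopWord P.L c.dir (off i.1) i.2.1 i.2.2))
              * ((loopHol (Averaging.iter (fun i => blockAvg (P := P) (j := i) (expMeanLogSU (n := n))) k U₀) c i :
                Matrix.specialUnitaryGroup n ℂ) : Matrix n n ℂ))
            * star ((corr (expMeanLogSU (n := n)) (Averaging.iter (fun i => blockAvg (P := P) (j := i) (expMeanLogSU (n := n))) k U₀) c :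
                Matrix.specialUnitaryGroup n ℂ) : Matrix n n ℂ)
          + ((corr (expMeanLogSU (n := n)) (Averaging.iter (fun i => blockAvg (P := P) (j := i) (expMeanLogSU (n := n))) k U₀) c :
                Matrix.specialUnitaryGroup n ℂ) : Matrix n n ℂ)
            * covWalkSum (Averaging.iter (fun i => blockAvg (P := P) (j := i) (expMeanLogSU (n := n))) k U₀) (G k)
                (walk (emb c.src) (List.replicate P.L (c.dir, true)))
            * star ((corr (expMeanLogSU (n := n)) (Averaging.iter (fun i => blockAvg (P := P) (j := i) (expMeanLogSU (n := n))) k U₀) c :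
                Matrix.specialUnitaryGroup n ℂ) : Matrix n n ℂ))
        - (CM k (G k) c.src
            - ((Averaging.iter (fun i => blockAvg (P := P) (j := i) (expMeanLogSU (n := n))) (k + 1) U₀ c : Matrix.specialUnitaryGroup n ℂ) :
                Matrix n n ℂ) * CM k (G k) c.tgt
              * star ((Averaging.iter (fun i => blockAvg (P := P) (j := i) (expMeanLogSU (n := n))) (k + 1) U₀ c :
                Matrix.specialUnitaryGroup n ℂ) : Matrix n n ℂ)))
    {k : ℕ} (hg : ∀ j < k, ∀ (c : PBond P (j + 1)) (i : Idx P),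
        dist1 (loopHol (Averaging.iter (fun i => blockAvg (P := P) (j := i) (expMeanLogSU (n := n))) j U₀) c i) < deltaSU n)
    (c : PBond P k) :
    ‖G k c‖ ≤ ‖Q k Y c‖ + ‖Λ k c.src‖ + ‖Λ k c.tgt‖ :=
  norm_reduced_le_of_structure _ (Λ k) c (trueLinIter_structure U₀ Q hQ0 hQs Y CM G Λ hG0 hΛ0 hΛs hGs k hg c)

end Summit.QuantumFields.YangMills.Theorems.Prop7TrueLinIterStructure

end
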